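import Summits.CriticalPhenomena.PercolationContinuityZ3.Theorems.PercNearOneGluingNoHeavyRsw3SlabTwoSpanningCritical
import Summits.CriticalPhenomena.PercolationContinuityZ3.Theorems.PercNearOneGluingNoHeavyRsw3SlabSealGeneral
import Summits.CriticalPhenomena.PercolationContinuityZ3.Theorems.PercNearOneGluingNoHeavyRsw3SlabPlateRenormalizationGeneral
import HarnessLib

/-!
# RSW3 lane (P2, gen 11): AIZENMAN'S `D_L(t, p_c) > 0` FOR `ℤ³` AT EVERY INTEGER ASPECT `t = 1/k`, `k ≥ 6` — the slab-box
# `{0..n} × {0..kn}²` contains two spanning clusters with probability `≥ c_k > 0` at `p_c(ℤ³)`, uniformly in `n`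

builds on p205010 (kernel theorem, internal audit signed; external expert review pending)

Cell `prim-rsw3`, prover seat `prim-rsw3-p2` (gen 11), memo `run/shared/lean/prim/rsw3/P2-RSWLITE.md` §17.
Support file (`--supports stmt-CriticalPhenomena-4575`); no definitions, no named facts, no sorries.  The `k`-general form of
`…Rsw3SlabTwoSpanningCritical` (`k = 6`):

  `exists_le_real_two_le_blockSpanningCount_easyShape_criticalProbI_of_six_le`:
  `∀ k ≥ 6, ∃ c > 0, ∀ n ≥ 1, c ≤ P_{p_c(ℤ³)}(2 ≤ Crossing.blockSpanningCount (easyShape k n) 0)`.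

Same proof at aspect `k`: slab seal (`…Rsw3SlabSealGeneral`), swap symmetry (`real_boxCross_swap_le`), plate renormalisation with range `k`
(`…Rsw3SlabPlateRenormalizationGeneral`), `θ(p_c) = 0` (p205010).  The constant `c_k` decays with `k` (Peierls constant at range `k`);
a `k`-UNIFORM constant for `k ≥ K` is the lane's gen-3 theorem `aizenman_two_le_blockSpanningCount_easyShape` (thin slabs, Aizenman's
original regime).  Together: Aizenman's `D_L(t,p_c) > 0` on `ℤ³` for every `t = 1/k`, `k ≥ 6` — his Remark 2 ("any other value of t … no
proof of such a principle for d > 2") for this family of aspects; `t ≥ 1/3` (the cube) is not reachable by this layout (memo §17, V40).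

References: M. Aizenman, Nucl. Phys. B 485 (1997) 551–582 (arXiv:cond-mat/9609240), §2 Thm. 2, Remark 2, criterion (ii) [Aizenman1997];
C. Borgs, J. Chayes, H. Kesten, J. Spencer, Random Structures Algorithms 15 (1999) 368–413, §1 [BorgsChayesKestenSpencer1999];
G. Grimmett, *Percolation* (1999), §1.6, §7.4 [GrimmettPercolation1999].
-/

noncomputable section

namespace Summit.CriticalPhenomena.PercolationContinuityZ3.Theorems.Rsw3

open MeasureTheory Literature.Probability.LatticeModels Literature.Probability.Percolation
open Literature.Probability.Percolation.KestenZhang Literature.Probability.Percolation.KozmaNitzan SimpleGraph Relation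
open Summit.CriticalPhenomena.PercolationContinuityZ3.Theorems.Crossing SurfaceTension

/-! ## Few spanning clusters force percolation: the every-`p` form -/

/-- **Few spanning clusters force percolation (every `p` with `θ(p) = 0`), `TwoSpan` form.**  With `η = δ_k^{(k+1)²}/2`, `δ_k = 1/(2·((k+1)²+2)·200^{(k+1)²})`, `σ₂ = P_p(boxCross (easyShape 2 n) 0)` and `S = Icc 0 (easyShape k n) = {0..n} × {0..kn}²`: if `θ(p) = 0` then for
every `n ≥ 1`, `min(η, σ₂²·η) ≤ P_p(TwoSpan(S))` (`S` contains open lattice paths `x ↔ y`, `x' ↔ y'` inside `S` with `x₀ = x'₀ = 0`,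
`y₀ = y'₀ = n`, `x ↮ x'` inside `S`).  Otherwise the slab seal (`sq_mul_real_compl_boxCross_le_real_twoSpan`), the swap symmetry
(`real_boxCross_swap_le`) and the plate renormalisation (`theta_pos_of_plate_slabUniq_criterion`) give `θ(p) > 0`.
[cite: Aizenman1997, §2 criterion (ii) and Thm. 2] -/
theorem le_real_twoSpan_of_theta_eq_zero_general (p : unitInterval) (hθ : theta (zdGraph 3) (0 : Site 3) p = 0) {k n : ℕ}
    (hk : 6 ≤ k) (hn : 1 ≤ n) :
    min ((1 / (2 * (((k : ℝ) + 1) ^ 2 + 2) * (2 * (3 ^ 2 + 1 : ℝ) ^ 2) ^ ((k + 1) ^ 2))) ^ ((k + 1) ^ 2) / 2)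
        ((bondPercolation (zdGraph 3) p).real (boxCross (easyShape 2 n) 0) ^ 2 *
          ((1 / (2 * (((k : ℝ) + 1) ^ 2 + 2) * (2 * (3 ^ 2 + 1 : ℝ) ^ 2) ^ ((k + 1) ^ 2))) ^ ((k + 1) ^ 2) / 2)) ≤
      (bondPercolation (zdGraph 3) p).real
        {ω : BondConfig (Site 3) | ∃ x ∈ Finset.Icc (0 : Site 3) (easyShape k n), ∃ x' ∈ Finset.Icc (0 : Site 3) (easyShape k n),
            ∃ y ∈ Finset.Icc (0 : Site 3) (easyShape k n), ∃ y' ∈ Finset.Icc (0 : Site 3) (easyShape k n),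
            x 0 = 0 ∧ x' 0 = 0 ∧ y 0 = (n : ℤ) ∧ y' 0 = (n : ℤ) ∧
            ω ∈ inConn ↑(Finset.Icc (0 : Site 3) (easyShape k n)) x y ∧
            ω ∈ inConn ↑(Finset.Icc (0 : Site 3) (easyShape k n)) x' y' ∧
            ω ∉ inConn ↑(Finset.Icc (0 : Site 3) (easyShape k n)) x x'} := by
  set μ := bondPercolation (zdGraph 3) p with hμ
  set η : ℝ := (1 / (2 * (((k : ℝ) + 1) ^ 2 + 2) * (2 * (3 ^ 2 + 1 : ℝ) ^ 2) ^ ((k + 1) ^ 2))) ^ ((k + 1) ^ 2) / 2 with hη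
  have hηpos : 0 < η := by rw [hη]; positivity
  set D := μ.real
        {ω : BondConfig (Site 3) | ∃ x ∈ Finset.Icc (0 : Site 3) (easyShape k n), ∃ x' ∈ Finset.Icc (0 : Site 3) (easyShape k n),
            ∃ y ∈ Finset.Icc (0 : Site 3) (easyShape k n), ∃ y' ∈ Finset.Icc (0 : Site 3) (easyShape k n),
            x 0 = 0 ∧ x' 0 = 0 ∧ y 0 = (n : ℤ) ∧ y' 0 = (n : ℤ) ∧
            ω ∈ inConn ↑(Finset.Icc (0 : Site 3) (easyShape k n)) x y ∧
            ω ∈ inConn ↑(Finset.Icc (0 : Site 3) (easyShape k n)) x' y' ∧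
            ω ∉ inConn ↑(Finset.Icc (0 : Site 3) (easyShape k n)) x x'} with hD
  set σ := μ.real (boxCross (easyShape 2 n) 0) with hσ
  by_contra hlt
  push Not at hlt
  have hD1 : D < η := lt_of_lt_of_le hlt (min_le_left _ _)
  have hD2 : D < σ ^ 2 * η := lt_of_lt_of_le hlt (min_le_right _ _)
  have hD0 : 0 ≤ D := measureReal_nonneg
  -- (1) the slab seal: `P((boxCross (n,2n,kn) 1)ᶜ) ≤ η`, since `σ² · P(…) ≤ D < σ² η`
  have hseal := sq_mul_real_compl_boxCross_le_real_twoSpan_general p hk hn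
  rw [← hμ] at hseal
  have hσpos : 0 < σ ^ 2 := by
    by_contra h0
    push Not at h0
    have : σ ^ 2 * η ≤ 0 := mul_nonpos_of_nonpos_of_nonneg h0 hηpos.le
    linarith
  have hplate1 : μ.real (boxCross ![(n : ℤ), 2 * (n : ℤ), (k : ℤ) * (n : ℤ)] 1)ᶜ ≤ η := by
    by_contra hgt
    push Not at hgt
    have : σ ^ 2 * η < σ ^ 2 * μ.real (boxCross ![(n : ℤ), 2 * (n : ℤ), (k : ℤ) * (n : ℤ)] 1)ᶜ := mul_lt_mul_of_pos_left hgt hσpos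
    linarith
  -- (2) the swap: `P((boxCross (2n,n,kn) 0)ᶜ) ≤ P((boxCross (n,2n,kn) 1)ᶜ)`
  have hswap : μ.real (boxCross ![2 * (n : ℤ), n, (k : ℤ) * (n : ℤ)] 0)ᶜ ≤ μ.real (boxCross ![(n : ℤ), 2 * (n : ℤ), (k : ℤ) * (n : ℤ)] 1)ᶜ := by
    rw [probReal_compl_eq_one_sub (measurableSet_boxCross _ _), probReal_compl_eq_one_sub (measurableSet_boxCross _ _)]
    have := real_boxCross_swap_le p (n : ℤ) ((k : ℤ) * (n : ℤ)) (b := 2 * (n : ℤ)) (by positivity)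
    rw [← hμ] at this
    linarith
  -- (3) the plate renormalisation gives percolation
  have e : η + η = (1 / (2 * (((k : ℝ) + 1) ^ 2 + 2) * (2 * (3 ^ 2 + 1 : ℝ) ^ 2) ^ ((k + 1) ^ 2))) ^ ((k + 1) ^ 2) := by
    rw [hη]; exact add_halves _
  have hpos : 0 < theta (zdGraph 3) (0 : Site 3) p :=
    theta_pos_of_plate_slabUniq_criterion_general p hk hn (e ▸ add_le_add (hswap.trans hplate1) hD1.le)
  -- (4) contradiction
  exact hpos.ne' hθ

/-- **Few spanning clusters force percolation, counting form** (every `p` with `θ(p) = 0`): `min(η, σ₂²·η) ≤ P_p(2 ≤ N^sp((n,kn,kn), 0))`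
for every `n ≥ 1`. [cite: Aizenman1997, §2 Thm. 2 and §5 (N_Free)] -/
theorem le_real_two_le_blockSpanningCount_of_theta_eq_zero_general (p : unitInterval)
    (hθ : theta (zdGraph 3) (0 : Site 3) p = 0) {k n : ℕ} (hk : 6 ≤ k) (hn : 1 ≤ n) :
    min ((1 / (2 * (((k : ℝ) + 1) ^ 2 + 2) * (2 * (3 ^ 2 + 1 : ℝ) ^ 2) ^ ((k + 1) ^ 2))) ^ ((k + 1) ^ 2) / 2)
        ((bondPercolation (zdGraph 3) p).real (boxCross (easyShape 2 n) 0) ^ 2 *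
          ((1 / (2 * (((k : ℝ) + 1) ^ 2 + 2) * (2 * (3 ^ 2 + 1 : ℝ) ^ 2) ^ ((k + 1) ^ 2))) ^ ((k + 1) ^ 2) / 2)) ≤
      (bondPercolation (zdGraph 3) p).real {ω | 2 ≤ blockSpanningCount (easyShape k n) 0 ω} :=
  (le_real_twoSpan_of_theta_eq_zero_general p hθ hk hn).trans
    (real_twoSpan_le_real_two_le_blockSpanningCount p (L := easyShape k n) (n := n) (by simp [easyShape]))

/-! ## At `p_c(ℤ³)`: two spanning clusters of the slab-box `{0..n} × {0..kn}²`, uniformly in `n` -/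

/-- **Aizenman's `D_L(1/k, p_c) > 0`, every integer `k ≥ 6`, for `ℤ³` — two spanning clusters in the slab-box `{0..n} × {0..kn}²` at criticality, uniformly
in the scale:** `∃ c > 0, ∀ n ≥ 1, c ≤ P_{p_c(ℤ³)}(2 ≤ blockSpanningCount (easyShape k n) 0)` (at least two distinct open clusters of the
block, free b.c., each meeting both faces `{x₀ = 0}` and `{x₀ = n}`; Aizenman's `N_Free ≥ 2`).  From
`le_real_two_le_blockSpanningCount_of_theta_eq_zero` at `p = p_c` (`θ(p_c) = 0`, p205010) and `σ₂ ≥ c_E` (`EasyCrossingLowerBound 2`).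
Aizenman 1997 Thm. 2 has this for thin slabs only (`t < t₀`); Remark 2 there: the bounded-`t` principle has "no proof for `d > 2`".
builds on p205010 (kernel theorem, internal audit signed; external expert review pending).
[cite: Aizenman1997, §2 Thm. 2 and Remark 2 ("we do not have a proof of such a principle for d > 2")]
[cite: BorgsChayesKestenSpencer1999, §1 (hyperscaling postulates: several macroscopic clusters)] -/
theorem exists_le_real_two_le_blockSpanningCount_easyShape_criticalProbI_of_six_le {k : ℕ} (hk : 6 ≤ k) :
    ∃ c : ℝ, 0 < c ∧ ∀ n : ℕ, 1 ≤ n →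
      c ≤ (bondPercolation (zdGraph 3) (criticalProbI 3)).real {ω | 2 ≤ blockSpanningCount (easyShape k n) 0 ω} := by
  obtain ⟨cE, hcE, hE⟩ := easyCrossingLowerBound_two
  set η : ℝ := (1 / (2 * (((k : ℝ) + 1) ^ 2 + 2) * (2 * (3 ^ 2 + 1 : ℝ) ^ 2) ^ ((k + 1) ^ 2))) ^ ((k + 1) ^ 2) / 2 with hη
  have hηpos : 0 < η := by rw [hη]; positivity
  refine ⟨min η (cE ^ 2 * η), lt_min hηpos (by positivity), fun n hn => ?_⟩
  have h0 : theta (zdGraph 3) (0 : Site 3) (criticalProbI 3) = 0 := CSH.percolationContinuity_allDimensions 3 (by norm_num)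
  have hmain := le_real_two_le_blockSpanningCount_of_theta_eq_zero_general (criticalProbI 3) h0 hk hn
  rw [← hη] at hmain
  have hσ : cE ^ 2 ≤ (bondPercolation (zdGraph 3) (criticalProbI 3)).real (boxCross (easyShape 2 n) 0) ^ 2 :=
    pow_le_pow_left₀ hcE.le (hE n hn) 2
  exact (min_le_min le_rfl (mul_le_mul_of_nonneg_right hσ hηpos.le)).trans hmain

/-- **`TwoSpan` form at `p_c(ℤ³)`:** with probability `≥ c` the slab-box `S = {0..n} × {0..kn}²` contains open lattice paths `x ↔ y`,
`x' ↔ y'` inside `S` with `x₀ = x'₀ = 0`, `y₀ = y'₀ = n`, `x ↮ x'` inside `S`, for every `n ≥ 1` — the uniqueness event of Aizenman's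
criterion (ii) FAILS with probability bounded below at the bounded aspect `t = 1/k` (gen 3's `aizenman_twoSpanningClusters_easyShape`: `t ≤ 1/K`).
builds on p205010 (kernel theorem, internal audit signed; external expert review pending). [cite: Aizenman1997, §2 Thm. 2 and Remark 2] -/
theorem exists_le_real_twoSpan_easyShape_criticalProbI_of_six_le {k : ℕ} (hk : 6 ≤ k) :
    ∃ c : ℝ, 0 < c ∧ ∀ n : ℕ, 1 ≤ n →
      c ≤ (bondPercolation (zdGraph 3) (criticalProbI 3)).real
        {ω : BondConfig (Site 3) | ∃ x ∈ Finset.Icc (0 : Site 3) (easyShape k n), ∃ x' ∈ Finset.Icc (0 : Site 3) (easyShape k n),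
            ∃ y ∈ Finset.Icc (0 : Site 3) (easyShape k n), ∃ y' ∈ Finset.Icc (0 : Site 3) (easyShape k n),
            x 0 = 0 ∧ x' 0 = 0 ∧ y 0 = (n : ℤ) ∧ y' 0 = (n : ℤ) ∧
            ω ∈ inConn ↑(Finset.Icc (0 : Site 3) (easyShape k n)) x y ∧
            ω ∈ inConn ↑(Finset.Icc (0 : Site 3) (easyShape k n)) x' y' ∧
            ω ∉ inConn ↑(Finset.Icc (0 : Site 3) (easyShape k n)) x x'} := by
  obtain ⟨cE, hcE, hE⟩ := easyCrossingLowerBound_two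
  set η : ℝ := (1 / (2 * (((k : ℝ) + 1) ^ 2 + 2) * (2 * (3 ^ 2 + 1 : ℝ) ^ 2) ^ ((k + 1) ^ 2))) ^ ((k + 1) ^ 2) / 2 with hη
  have hηpos : 0 < η := by rw [hη]; positivity
  refine ⟨min η (cE ^ 2 * η), lt_min hηpos (by positivity), fun n hn => ?_⟩
  have h0 : theta (zdGraph 3) (0 : Site 3) (criticalProbI 3) = 0 := CSH.percolationContinuity_allDimensions 3 (by norm_num)
  have hmain := le_real_twoSpan_of_theta_eq_zero_general (criticalProbI 3) h0 hk hn
  rw [← hη] at hmain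
  have hσ : cE ^ 2 ≤ (bondPercolation (zdGraph 3) (criticalProbI 3)).real (boxCross (easyShape 2 n) 0) ^ 2 :=
    pow_le_pow_left₀ hcE.le (hE n hn) 2
  exact (min_le_min le_rfl (mul_le_mul_of_nonneg_right hσ hηpos.le)).trans hmain

end Summit.CriticalPhenomena.PercolationContinuityZ3.Theorems.Rsw3

end
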